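import Summits.NavierStokesRegularity.NavierStokesRegularity.Theses.AngularGalerkinLadder
import Literature.Analysis.FluidPDE.AxisymNoSwirlVorticity
import HarnessLib

/-!
# Census stratum (S10): no rung profile — a fortiori no K2 window profile — is invariant in norm
# under a translation or a screw displacement of non-zero pitch (2D, 2½D, axially periodic and
# helically symmetric profiles are all excluded by Type-I spatial decay alone)

Refuter seat (ns-blowup-refuter g17), kernel census for crux K2 `NoOverheating`
(stmt-NavierStokesRegularity-19960) of route `AngularGalerkinLadder`, Negative lane (`--supports`).
No definition, no named fact, no item verdict moves.

The classical symmetry classes in which Navier–Stokes is globally regular — plane flows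
(Ladyzhenskaya), 2½D flows `u(x + s e₃) = u(x)`, and helically symmetric flows
`u(R_θ x + (hθ/2π) e₃) = R_θ u(x)` (Mahalov–Titi–Leibovich) — share one feature: the symmetry group
contains an isometry `y ↦ S y + b` with `S b = b`, `b ≠ 0`, whose orbits `Sⁿ x + n b` escape to
infinity. A profile slice that is invariant IN NORM under such a map and obeys the Type-I spatial
decay `‖u(t,x)‖ ≤ C₀ / (‖x‖ + √−t)` of a rung profile is therefore identically zero
(`eq_zero_of_norm_screw_invariant_of_decay`): the orbit carries the constant value `‖u(t,x)‖` out to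
where the envelope vanishes. Consequences booked for the census:

* `rungProfile_slice_eq_zero_of_screw_invariant` / `not_nontrivial_rungProfile_of_screw_invariant`:
  a rung profile (`IsRungProfile`, any rung, any window data) with one screw- or translation-invariant
  slice norm has that slice `≡ 0`; with all slices invariant it is NOT a `RungIsSingular` witness;
* `no_windowProfile_screw_invariant`, `no_windowProfile_translation_invariant`,
  `no_windowProfile_helical`: a SINGLE window profile (`0 < δ`) whose `t = −1` slice is invariant in
  norm under a screw / a translation / a helical motion about the ladder axis is contradictory — no
  sequence, no limit, no threshold;
* `not_cofinal_and_noOverheating_screw_invariant`: the K1 ∧ K2-supply reading.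
So stratum (S10) ⊇ {2D, 2½D, x₃-periodic, helical profiles} is empty at every rung, and the live K2
region keeps only profiles with NO isometric symmetry having unbounded orbits.

References: [cite: MahalovTitiLeibovich1990, main theorem (global strong solutions with helical symmetry; quoted in Robinson–Rodrigo–Sadowski 2016, PDF p. 112)]; [cite: KochNadirashviliSereginSverak2009, (1.6)];
[cite: ChaeWolf2017, Def. 1.1].
-/

noncomputable section

namespace Summit.NavierStokesRegularity.AngularGalerkinLadderTranslationalSymmetryExcluded

open Set Function Filter Topology
open Literature.Analysis.FluidPDE
open Summit.NavierStokesRegularity.FluidComputer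
open Summit.NavierStokesRegularity.FluidComputer.AngularLadder
open Summit.NavierStokesRegularity.NavierStokesRegularity.Theses.AngularGalerkinLadder

/-! ### §1 Orbits of a screw displacement escape to infinity -/

/-- For the screw displacement `g y = S y + b` with `S b = b`: `gⁿ x − n b = Sⁿ x`, so its norm is
`‖x‖`. [folklore] -/
theorem norm_iterate_screw_sub (S : EuclideanSpace ℝ (Fin 3) ≃ₗᵢ[ℝ] EuclideanSpace ℝ (Fin 3))
    {b : EuclideanSpace ℝ (Fin 3)} (hSb : S b = b) (x : EuclideanSpace ℝ (Fin 3)) (n : ℕ) :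
    ‖(fun y => S y + b)^[n] x - (n : ℝ) • b‖ = ‖x‖ := by
  induction n with
  | zero => simp
  | succ n ih =>
    rw [Function.iterate_succ_apply', Nat.cast_succ, add_smul, one_smul]
    have h : S ((fun y => S y + b)^[n] x) + b - ((n : ℝ) • b + b)
        = S ((fun y => S y + b)^[n] x - (n : ℝ) • b) := by
      rw [map_sub, LinearIsometryEquiv.map_smul, hSb]
      abel
    rw [h, LinearIsometryEquiv.norm_map, ih]

/-- The orbit of a screw displacement with `S b = b` escapes linearly: `n‖b‖ − ‖x‖ ≤ ‖gⁿ x‖`.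
[folklore] -/
theorem le_norm_iterate_screw (S : EuclideanSpace ℝ (Fin 3) ≃ₗᵢ[ℝ] EuclideanSpace ℝ (Fin 3))
    {b : EuclideanSpace ℝ (Fin 3)} (hSb : S b = b) (x : EuclideanSpace ℝ (Fin 3)) (n : ℕ) :
    (n : ℝ) * ‖b‖ - ‖x‖ ≤ ‖(fun y => S y + b)^[n] x‖ := by
  have h1 : ‖(n : ℝ) • b‖ = (n : ℝ) * ‖b‖ := by
    rw [norm_smul, Real.norm_natCast]
  have h2 : ‖(n : ℝ) • b‖ - ‖(fun y => S y + b)^[n] x‖ ≤ ‖x‖ :=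
    calc ‖(n : ℝ) • b‖ - ‖(fun y => S y + b)^[n] x‖
        ≤ ‖(n : ℝ) • b - (fun y => S y + b)^[n] x‖ := norm_sub_norm_le _ _
      _ = ‖x‖ := by rw [norm_sub_rev, norm_iterate_screw_sub S hSb x n]
  linarith

/-! ### §2 Decay kills norm-invariant slices -/

/-- **An envelope `C / (‖x‖ + a)` is incompatible with norm-invariance under a screw displacement of
non-zero pitch**: if `‖w (S x + b)‖ = ‖w x‖` for all `x` (`S b = b`, `b ≠ 0`) and
`‖w x‖ ≤ C / (‖x‖ + a)`, then `w ≡ 0` (the orbit `Sⁿx + n b` carries the value `‖w x‖` out to where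
the envelope vanishes; no sign condition on `C` or `a` is needed). [folklore] -/
theorem eq_zero_of_norm_screw_invariant_of_decay
    {w : EuclideanSpace ℝ (Fin 3) → EuclideanSpace ℝ (Fin 3)} {C a : ℝ}
    (S : EuclideanSpace ℝ (Fin 3) ≃ₗᵢ[ℝ] EuclideanSpace ℝ (Fin 3)) {b : EuclideanSpace ℝ (Fin 3)}
    (hSb : S b = b) (hb : b ≠ 0) (hinv : ∀ x, ‖w (S x + b)‖ = ‖w x‖)
    (hdec : ∀ x, ‖w x‖ ≤ C / (‖x‖ + a)) (x : EuclideanSpace ℝ (Fin 3)) : w x = 0 := by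
  set g : EuclideanSpace ℝ (Fin 3) → EuclideanSpace ℝ (Fin 3) := fun y => S y + b with hg
  -- the norm is constant along the orbit
  have horbit : ∀ n : ℕ, ‖w (g^[n] x)‖ = ‖w x‖ := by
    intro n
    induction n with
    | zero => simp
    | succ n ih => rw [Function.iterate_succ_apply', hg, hinv, ← hg, ih]
  -- the envelope along the orbit tends to zero
  have hden : Tendsto (fun n : ℕ => ‖g^[n] x‖ + a) atTop atTop := by
    refine tendsto_atTop_mono (fun n => ?_)
      (tendsto_atTop_add_const_right atTop (a - ‖x‖)
        (Tendsto.atTop_mul_const (norm_pos_iff.mpr hb) tendsto_natCast_atTop_atTop))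
    have := le_norm_iterate_screw S hSb x n
    simp only [hg] at this ⊢
    linarith
  have hlim : Tendsto (fun n : ℕ => C / (‖g^[n] x‖ + a)) atTop (𝓝 0) :=
    tendsto_const_nhds.div_atTop hden
  have hle : ‖w x‖ ≤ 0 :=
    ge_of_tendsto' hlim fun n => by rw [← horbit n]; exact hdec _
  exact norm_le_zero_iff.mp hle

/-- **Type-I spatial decay kills every screw- or translation-invariant slice of a profile.**
[cite: KochNadirashviliSereginSverak2009, (1.6)] -/
theorem slice_eq_zero_of_hasTypeIDecay_of_screw_invariant {C₀ : ℝ}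
    {u : ℝ → EuclideanSpace ℝ (Fin 3) → EuclideanSpace ℝ (Fin 3)} (hTI : HasTypeIDecay C₀ u)
    (S : EuclideanSpace ℝ (Fin 3) ≃ₗᵢ[ℝ] EuclideanSpace ℝ (Fin 3)) {b : EuclideanSpace ℝ (Fin 3)}
    (hSb : S b = b) (hb : b ≠ 0) {t : ℝ} (ht : t < 0)
    (hinv : ∀ x, ‖u t (S x + b)‖ = ‖u t x‖) (x : EuclideanSpace ℝ (Fin 3)) : u t x = 0 :=
  eq_zero_of_norm_screw_invariant_of_decay S hSb hb hinv (hTI t ht) x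

/-! ### §3 Rung profiles and window profiles -/

variable {L : ℕ} {C₀ cmin cmax δ ε c : ℝ}
  {R : EuclideanSpace ℝ (Fin 3) ≃ₗᵢ[ℝ] EuclideanSpace ℝ (Fin 3)}
  {u : ℝ → EuclideanSpace ℝ (Fin 3) → EuclideanSpace ℝ (Fin 3)}
  {p : ℝ → EuclideanSpace ℝ (Fin 3) → ℝ}
  {d : ℝ → EuclideanSpace ℝ (Fin 3) → EuclideanSpace ℝ (Fin 3)}

/-- **A rung profile with a screw- or translation-invariant slice norm has that slice `≡ 0`** (any rung
`L`, any DSS data, any window). [cite: ChaeWolf2017, Def. 1.1] -/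
theorem rungProfile_slice_eq_zero_of_screw_invariant (hP : IsRungProfile L C₀ c R u p d)
    (S : EuclideanSpace ℝ (Fin 3) ≃ₗᵢ[ℝ] EuclideanSpace ℝ (Fin 3)) {b : EuclideanSpace ℝ (Fin 3)}
    (hSb : S b = b) (hb : b ≠ 0) {t : ℝ} (ht : t < 0)
    (hinv : ∀ x, ‖u t (S x + b)‖ = ‖u t x‖) : ∀ x, u t x = 0 :=
  slice_eq_zero_of_hasTypeIDecay_of_screw_invariant hP.hasTypeIDecay S hSb hb ht hinv

/-- **(S10) at the level of K1's witnesses**: a rung profile all of whose slices are invariant in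
norm under one screw displacement of non-zero pitch is trivial, so it never witnesses
`RungIsSingular L`. [cite: MahalovTitiLeibovich1990, main theorem (global strong solutions with helical symmetry; quoted in Robinson–Rodrigo–Sadowski 2016, PDF p. 112)] -/
theorem not_nontrivial_rungProfile_of_screw_invariant (hP : IsRungProfile L C₀ c R u p d)
    (S : EuclideanSpace ℝ (Fin 3) ≃ₗᵢ[ℝ] EuclideanSpace ℝ (Fin 3)) {b : EuclideanSpace ℝ (Fin 3)}
    (hSb : S b = b) (hb : b ≠ 0) (hinv : ∀ t < 0, ∀ x, ‖u t (S x + b)‖ = ‖u t x‖) :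
    ¬ ∃ t < 0, ∃ x, u t x ≠ 0 := by
  rintro ⟨t, ht, x, hx⟩
  exact hx (rungProfile_slice_eq_zero_of_screw_invariant hP S hSb hb ht (hinv t ht) x)

/-- **(S10) No window profile is screw-invariant at `t = −1`**: a single window profile with
`0 < δ` whose `t = −1` slice norm is invariant under `y ↦ S y + b` (`S b = b`, `b ≠ 0`) is
contradictory. [cite: KochNadirashviliSereginSverak2009, (1.6)] -/
theorem no_windowProfile_screw_invariant (hδ : 0 < δ)
    (hW : IsWindowProfile L C₀ cmin cmax δ ε c R u p d)
    (S : EuclideanSpace ℝ (Fin 3) ≃ₗᵢ[ℝ] EuclideanSpace ℝ (Fin 3)) {b : EuclideanSpace ℝ (Fin 3)}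
    (hSb : S b = b) (hb : b ≠ 0) (hinv : ∀ x, ‖u (-1) (S x + b)‖ = ‖u (-1) x‖) : False := by
  obtain ⟨hP, -, -, ⟨x, hx⟩, -⟩ := hW
  have h0 := rungProfile_slice_eq_zero_of_screw_invariant hP S hSb hb
    (by norm_num : (-1 : ℝ) < 0) hinv x
  rw [h0, norm_zero] at hx
  exact absurd hx (not_le.mpr hδ)

/-- **(S10a) translations**: no window profile has a `t = −1` slice norm invariant under a non-zero
translation — this covers axially periodic profiles and, a fortiori, `x₃`-independent (2D / 2½D)
profiles. [folklore] -/
theorem no_windowProfile_translation_invariant (hδ : 0 < δ)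
    (hW : IsWindowProfile L C₀ cmin cmax δ ε c R u p d) {b : EuclideanSpace ℝ (Fin 3)} (hb : b ≠ 0)
    (hinv : ∀ x, ‖u (-1) (x + b)‖ = ‖u (-1) x‖) : False :=
  no_windowProfile_screw_invariant hδ hW (LinearIsometryEquiv.refl ℝ _) rfl hb
    (fun x => by simpa using hinv x)

/-- **(S10b) helical symmetry about the ladder axis**: no window profile has a `t = −1` slice norm
invariant under the helical motion `y ↦ R_θ y + b` with `b ≠ 0` on the axis (`b₀ = b₁ = 0`; pitch
`b`, any angle `θ`) — the Mahalov–Titi–Leibovich class. [cite: MahalovTitiLeibovich1990, main theorem (global strong solutions with helical symmetry; quoted in Robinson–Rodrigo–Sadowski 2016, PDF p. 112)] -/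
theorem no_windowProfile_helical (hδ : 0 < δ)
    (hW : IsWindowProfile L C₀ cmin cmax δ ε c R u p d) (θ : ℝ) {b : EuclideanSpace ℝ (Fin 3)}
    (hb0 : b 0 = 0) (hb1 : b 1 = 0) (hb : b ≠ 0)
    (hinv : ∀ x, ‖u (-1) (rotZ θ x + b)‖ = ‖u (-1) x‖) : False :=
  no_windowProfile_screw_invariant hδ hW (rotZLIE θ) (by simp [rotZ_eq_self_of_axis θ hb0 hb1]) hb
    (fun x => by simpa using hinv x)

/-- **Equivariant form** (the usual definition of a helical / 2½D vector field,
`u(S y + b) = S u(y)`): it implies norm-invariance, hence is excluded too. [folklore] -/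
theorem no_windowProfile_screw_equivariant (hδ : 0 < δ)
    (hW : IsWindowProfile L C₀ cmin cmax δ ε c R u p d)
    (S : EuclideanSpace ℝ (Fin 3) ≃ₗᵢ[ℝ] EuclideanSpace ℝ (Fin 3)) {b : EuclideanSpace ℝ (Fin 3)}
    (hSb : S b = b) (hb : b ≠ 0) (hequi : ∀ x, u (-1) (S x + b) = S (u (-1) x)) : False :=
  no_windowProfile_screw_invariant hδ hW S hSb hb
    (fun x => by rw [hequi x, LinearIsometryEquiv.norm_map])

/-! ### §4 The K1 ∧ K2 reading -/

/-- **K1 ∧ (K2 supplied by screw- or translation-symmetric window profiles) is contradictory** — at the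
FIRST singular rung past `L₀`, with no limit and no threshold. [cite: MahalovTitiLeibovich1990, main theorem (global strong solutions with helical symmetry; quoted in Robinson–Rodrigo–Sadowski 2016, PDF p. 112)] -/
theorem not_cofinal_and_noOverheating_screw_invariant (C₀ : ℝ) :
    ¬ (RungBlowupCofinal ∧ ∃ (cmin cmax δ : ℝ) (L₀ : ℕ) (ε : ℕ → ℝ), 1 < cmin ∧ 0 < δ ∧
        Tendsto ε atTop (𝓝 0) ∧ ∀ L ≥ L₀, RungIsSingular L →
          ∃ (c : ℝ) (R : EuclideanSpace ℝ (Fin 3) ≃ₗᵢ[ℝ] EuclideanSpace ℝ (Fin 3))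
            (u : ℝ → EuclideanSpace ℝ (Fin 3) → EuclideanSpace ℝ (Fin 3))
            (p : ℝ → EuclideanSpace ℝ (Fin 3) → ℝ)
            (d : ℝ → EuclideanSpace ℝ (Fin 3) → EuclideanSpace ℝ (Fin 3)),
            IsWindowProfile L C₀ cmin cmax δ (ε L) c R u p d ∧
              ∃ (S : EuclideanSpace ℝ (Fin 3) ≃ₗᵢ[ℝ] EuclideanSpace ℝ (Fin 3))
                (b : EuclideanSpace ℝ (Fin 3)), S b = b ∧ b ≠ 0 ∧
                  ∀ x, ‖u (-1) (S x + b)‖ = ‖u (-1) x‖) := by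
  rintro ⟨h₁, cmin, cmax, δ, L₀, ε, -, hδ, -, hwin⟩
  obtain ⟨L, hL, hsing⟩ := h₁ L₀
  obtain ⟨c, R, u, p, d, hW, S, b, hSb, hb, hinv⟩ := hwin L hL hsing
  exact no_windowProfile_screw_invariant hδ hW S hSb hb hinv

/-- Supply form: a K2 met by screw- or translation-symmetric window profiles refutes K1.
[cite: MahalovTitiLeibovich1990, main theorem (global strong solutions with helical symmetry; quoted in Robinson–Rodrigo–Sadowski 2016, PDF p. 112)] -/
theorem rungBlowupCofinal_false_of_noOverheating_screw_invariant (C₀ : ℝ)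
    (h : ∃ (cmin cmax δ : ℝ) (L₀ : ℕ) (ε : ℕ → ℝ), 1 < cmin ∧ 0 < δ ∧
        Tendsto ε atTop (𝓝 0) ∧ ∀ L ≥ L₀, RungIsSingular L →
          ∃ (c : ℝ) (R : EuclideanSpace ℝ (Fin 3) ≃ₗᵢ[ℝ] EuclideanSpace ℝ (Fin 3))
            (u : ℝ → EuclideanSpace ℝ (Fin 3) → EuclideanSpace ℝ (Fin 3))
            (p : ℝ → EuclideanSpace ℝ (Fin 3) → ℝ)
            (d : ℝ → EuclideanSpace ℝ (Fin 3) → EuclideanSpace ℝ (Fin 3)),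
            IsWindowProfile L C₀ cmin cmax δ (ε L) c R u p d ∧
              ∃ (S : EuclideanSpace ℝ (Fin 3) ≃ₗᵢ[ℝ] EuclideanSpace ℝ (Fin 3))
                (b : EuclideanSpace ℝ (Fin 3)), S b = b ∧ b ≠ 0 ∧
                  ∀ x, ‖u (-1) (S x + b)‖ = ‖u (-1) x‖) :
    ¬ RungBlowupCofinal := fun h₁ =>
  not_cofinal_and_noOverheating_screw_invariant C₀ ⟨h₁, h⟩

end Summit.NavierStokesRegularity.AngularGalerkinLadderTranslationalSymmetryExcluded

end
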